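import Literature.NumberTheory.EllipticCurves.ShintaniLiftTermwise
import Literature.NumberTheory.EllipticCurves.ShintaniLatticeAction
import Literature.NumberTheory.EllipticCurves.OrbitStabilizerSums
import HarnessLib

/-!
# Unfolding the Shintani lift orbit by orbit: `∑_{q ∈ Γ/Γ_{k₀}} ∫_F term(q • k₀) = ∫_{F_{k₀}} term(k₀)`

[[cite: Shintani1975, §2, (2.9), (2.12), (2.14)]] — second step of the unfolding of
`Φ_D = √(Im z) ∑_k ∫_F term_k` (`ShintaniLiftTermwise`): the lattice sum is regrouped over the
orbits of `Γ = Γ₀(64)⁺` on `ℤ³` (`ShintaniLatticeAction`, `OrbitStabilizerSums`) and each orbit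
sum is an integral over a fundamental domain `F_{k₀} = ⋃_{r} r • F` of the stabiliser `Γ_{k₀}`
(`Gamma0FundamentalDomain`).  We PROVE:

* `liftTerm_smul` — **equivariance** `term(γ • k)(w) = term(k)(γ⁻¹ w)` (`D` odd, `φ ∈ S₂(Γ₀(64))`:
  weight `2` of `φ`, weight `-2` of `w ↦ f_{w,Z}`, invariance of `c_D`);
* `isFundamentalDomain_liftDomain` — `F` is a fundamental domain for `Γ₀(64)⁺`;
  `summable_norm_integral_liftTerm`, `integrableOn_liftTerm`, `summable_integral_norm_liftTerm`;
* `cosetRepInv`, `quotEquivCosetRepInv`, `orbitDomain k₀ = ⋃_{r ∈ R} r • F` (`R = {(q.out)⁻¹}`),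
  `isFundamentalDomain_orbitDomain` — `F_{k₀}` is a fundamental domain for `Γ_{k₀}`;
* **`tsum_quotient_integral_liftTerm_eq`** — `term(k₀)` is integrable on `F_{k₀}` and
  `∑_{q ∈ Γ/Γ_{k₀}} ∫_F term(q.out • k₀) = ∫_{F_{k₀}} term(k₀)`;
* `liftTerm_stab_invariant` (`term(k₀)` is `Γ_{k₀}`-invariant), the measurable / invariant-measure
  structure of subgroups of `Γ₀(64)⁺` acting on `ℍ`, and translation of set integrals by `SL₂(ℤ)`.

No named facts; the definitions are `stabK` (an `abbrev` for the stabiliser), `cosetRepInv`,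
`quotEquivCosetRepInv`, `orbitDomain` and the instances.
-/

noncomputable section

open scoped MatrixGroups ModularForm Modular Topology ENNReal Pointwise
open UpperHalfPlane hiding I
open Complex Filter MeasureTheory Set CongruenceSubgroup ModularGroup Real
open Literature.NumberTheory.EllipticCurves.ModularForms

namespace Literature.NumberTheory.EllipticCurves.Shintani

variable (D : ℕ) [NeZero D]

/-! ### Equivariance of the terms -/

/-- **`term(γ • k)(w) = term(k)(γ⁻¹ w)`** for `γ ∈ Γ₀(64)⁺`, `φ ∈ S₂(Γ₀(64))`, `D` odd: the
weight `2` of `φ` against the weight `-2` of `w ↦ f_{w,Z}` and the invariance of `c_D`.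
[cite: Shintani1975, (2.12)] -/
theorem liftTerm_smul (hD : Odd D) (f : CuspForm (Gamma0 64) 2) (z : ℍ) (γ : Gamma0Plus 64)
    (k : Fin 3 → ℤ) (w : ℍ) :
    liftTerm D f z (γ • k) w = liftTerm D f z k (((γ : SL(2, ℤ))⁻¹) • w) := by
  unfold liftTerm
  set g : SL(2, ℤ) := (γ : SL(2, ℤ))⁻¹ with hg
  have hgmem : g ∈ Gamma0 64 := (Gamma0 64).inv_mem (Gamma0Plus_le γ.2)
  have hmem : (g : GL (Fin 2) ℝ) ∈ (Gamma0 64 : Subgroup (GL (Fin 2) ℝ)) := ⟨g, hgmem, rfl⟩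
  have h1 : f (g • w) = (denom (g : GL (Fin 2) ℝ) w) ^ (2 : ℤ) * f w := by
    have := SlashInvariantForm.slash_action_eqn'' f hmem w
    simpa using this
  rw [ModularGroup.denom_apply] at h1
  rw [invWeight_smul (invWeight_cD hD), shintaniFn_latSharp_smul, ← hg, h1, zpow_ofNat]
  ring

/-! ### The group `Γ₀(64)⁺`, its domain, and summability of the orbit sums -/

/-- The lift's domain is the `Γ₀(N)⁺`-fundamental domain of `Gamma0FundamentalDomain`. [folklore] -/
theorem liftDomain_eq_gamma0Domain : liftDomain = gamma0Domain reps := rfl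

/-- `F` is a fundamental domain for `Γ₀(64)⁺`. [cite: DiamondShurman2005, §2.3–2.4] -/
theorem isFundamentalDomain_liftDomain :
    IsFundamentalDomain (Gamma0Plus 64) liftDomain (volume : Measure ℍ) := by
  rw [liftDomain_eq_gamma0Domain]
  exact isFundamentalDomain_gamma0Domain reps reps_spec (by norm_num)

/-- The term integrals `k ↦ ∫_F term_k` are absolutely summable. [folklore] -/
theorem summable_norm_integral_liftTerm (f : CuspForm (Gamma0 64) 2) (z : ℍ) :
    Summable fun k : Fin 3 → ℤ ↦ ‖∫ w in liftDomain, liftTerm D f z k w‖ := by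
  have h := tsum_lintegral_enorm_liftTerm_ne_top D f z
  -- `‖∫ term_k‖ ≤ ∫ ‖term_k‖`, and the latter are summable with finite total
  have hle : ∀ k, ‖∫ w in liftDomain, liftTerm D f z k w‖ ≤
      (∫⁻ w in liftDomain, ‖liftTerm D f z k w‖ₑ).toReal := by
    intro k
    refine (norm_integral_le_lintegral_norm _).trans (le_of_eq ?_)
    congr 1
    refine lintegral_congr fun w ↦ ?_
    rw [ofReal_norm]
  have hfin : ∀ k, ∫⁻ w in liftDomain, ‖liftTerm D f z k w‖ₑ ≠ ∞ :=
    fun k ↦ ENNReal.ne_top_of_tsum_ne_top h k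
  refine Summable.of_nonneg_of_le (fun _ ↦ norm_nonneg _) hle ?_
  exact ENNReal.summable_toReal h

/-! ### The coset representatives and the unfolded domain of an orbit -/

variable {D}

section Orbit

variable (k₀ : Fin 3 → ℤ)

/-- The stabiliser `Γ_{k₀} ≤ Γ₀(64)⁺`. [folklore] -/
abbrev stabK : Subgroup (Gamma0Plus 64) := MulAction.stabilizer (Gamma0Plus 64) k₀

/-- The inverses of the chosen coset representatives of `Γ₀(64)⁺/Γ_{k₀}`. [folklore] -/
def cosetRepInv : Set (Gamma0Plus 64) := Set.range fun q : Gamma0Plus 64 ⧸ stabK k₀ ↦ (q.out)⁻¹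

/-- The covering property of the representatives: every `g` has `r ∈ R` with `r g ∈ Γ_{k₀}`.
[folklore] -/
theorem cosetRepInv_cov (g : Gamma0Plus 64) : ∃ r ∈ cosetRepInv k₀, r * g ∈ stabK k₀ := by
  refine ⟨((QuotientGroup.mk g : Gamma0Plus 64 ⧸ stabK k₀).out)⁻¹, ⟨_, rfl⟩, ?_⟩
  obtain ⟨h, hh⟩ := QuotientGroup.mk_out_eq_mul (stabK k₀) g
  rw [hh, _root_.mul_inv_rev, inv_mul_cancel_right]
  exact (stabK k₀).inv_mem h.2

/-- The uniqueness property of the representatives. [folklore] -/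
theorem cosetRepInv_uniq (r : Gamma0Plus 64) (hr : r ∈ cosetRepInv k₀) (r' : Gamma0Plus 64)
    (hr' : r' ∈ cosetRepInv k₀) (h : r' * r⁻¹ ∈ stabK k₀) : r = r' := by
  obtain ⟨q, rfl⟩ := hr
  obtain ⟨q', rfl⟩ := hr'
  rw [inv_inv] at h
  have : (QuotientGroup.mk q'.out : Gamma0Plus 64 ⧸ stabK k₀) = QuotientGroup.mk q.out :=
    QuotientGroup.eq.mpr h
  rw [QuotientGroup.out_eq', QuotientGroup.out_eq'] at this
  rw [this]

/-- The bijection `Γ₀(64)⁺/Γ_{k₀} ≃ R`, `q ↦ (q.out)⁻¹`. [folklore] -/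
def quotEquivCosetRepInv : (Gamma0Plus 64 ⧸ stabK k₀) ≃ cosetRepInv k₀ :=
  Equiv.ofBijective (fun q ↦ ⟨(q.out)⁻¹, ⟨q, rfl⟩⟩) (by
    constructor
    · intro q q' h
      have h1 : (q.out)⁻¹ = (q'.out)⁻¹ := congrArg Subtype.val h
      have h2 : q.out = q'.out := inv_injective h1
      rw [← QuotientGroup.out_eq' q, ← QuotientGroup.out_eq' q', h2]
    · rintro ⟨r, q, rfl⟩
      exact ⟨q, rfl⟩)

/-- The unfolded domain of the orbit of `k₀`: `F_{k₀} = ⋃_{r ∈ R} r • F`. [folklore] -/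
def orbitDomain : Set ℍ := ⋃ r ∈ cosetRepInv k₀, r • liftDomain

/-- **`F_{k₀}` is a fundamental domain for the stabiliser `Γ_{k₀}`.** [folklore] -/
theorem isFundamentalDomain_orbitDomain :
    IsFundamentalDomain (stabK k₀) (orbitDomain k₀) (volume : Measure ℍ) :=
  isFundamentalDomain_iUnion_smul isFundamentalDomain_liftDomain (stabK k₀) (cosetRepInv k₀)
    (cosetRepInv_cov k₀) (cosetRepInv_uniq k₀)

end Orbit

/-! ### The orbit identity -/

section OrbitIdentity

variable (D)

/-- Translating a set integral by a group element (invariance of `μ`). [folklore] -/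
theorem setIntegral_smul_set {E : Type*} [NormedAddCommGroup E] [NormedSpace ℝ E] (r : Gamma0Plus 64)
    (g : ℍ → E) (S : Set ℍ) : ∫ x in r • S, g x = ∫ x in S, g (r • x) := by
  have hmp := measurePreserving_smul r (volume : Measure ℍ)
  rw [← Set.image_smul, hmp.setIntegral_image_emb (measurableEmbedding_const_smul r) g S]

/-- Integrability transported along a translation. [folklore] -/
theorem integrableOn_smul_set_iff {E : Type*} [NormedAddCommGroup E] (r : Gamma0Plus 64) (g : ℍ → E)
    (S : Set ℍ) : IntegrableOn g (r • S) ↔ IntegrableOn (fun x ↦ g (r • x)) S := by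
  have hmp := measurePreserving_smul r (volume : Measure ℍ)
  rw [← Set.image_smul]
  exact hmp.integrableOn_image (measurableEmbedding_const_smul r)

/-- The action of `Γ₀(64)⁺` on `ℍ` through `SL₂(ℤ)`. [folklore] -/
theorem coe_inv_smul (γ : Gamma0Plus 64) (w : ℍ) : ((γ : SL(2, ℤ))⁻¹) • w = (γ⁻¹ : Gamma0Plus 64) • w := rfl

/-- Each term is integrable on `F`. [folklore] -/
theorem integrableOn_liftTerm (f : CuspForm (Gamma0 64) 2) (z : ℍ) (k : Fin 3 → ℤ) :
    IntegrableOn (liftTerm D f z k) liftDomain := by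
  have hmeas : Measurable (liftTerm D f z k) :=
    measurable_liftTerm D (CuspFormClass.holo f).continuous.measurable z k
  refine ⟨hmeas.aestronglyMeasurable, ?_⟩
  rw [hasFiniteIntegral_iff_enorm]
  exact lt_top_iff_ne_top.mpr (ENNReal.ne_top_of_tsum_ne_top (tsum_lintegral_enorm_liftTerm_ne_top D f z) k)

/-- `∫_F ‖term_k‖` as the real part of the finite `lintegral`. [folklore] -/
theorem integral_norm_liftTerm_eq_toReal (f : CuspForm (Gamma0 64) 2) (z : ℍ) (k : Fin 3 → ℤ) :
    ∫ w in liftDomain, ‖liftTerm D f z k w‖ = (∫⁻ w in liftDomain, ‖liftTerm D f z k w‖ₑ).toReal := by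
  rw [integral_norm_eq_lintegral_enorm (integrableOn_liftTerm D f z k).aestronglyMeasurable]

/-- The integrals of the norms of the terms are summable. [folklore] -/
theorem summable_integral_norm_liftTerm (f : CuspForm (Gamma0 64) 2) (z : ℍ) :
    Summable fun k : Fin 3 → ℤ ↦ ∫ w in liftDomain, ‖liftTerm D f z k w‖ := by
  simp_rw [integral_norm_liftTerm_eq_toReal]
  exact ENNReal.summable_toReal (tsum_lintegral_enorm_liftTerm_ne_top D f z)

variable {D}

/-- **The orbit identity**: for `D` odd, `φ ∈ S₂(Γ₀(64))` and a base vector `k₀`,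
`∑_{q ∈ Γ/Γ_{k₀}} ∫_F term(q.out • k₀) = ∫_{F_{k₀}} term(k₀)` where `F_{k₀} = ⋃_{r} r • F` is a
fundamental domain of the stabiliser `Γ_{k₀}` — and the integrand `term(k₀)` is integrable there.
[cite: Shintani1975, §2, (2.9)] -/
theorem tsum_quotient_integral_liftTerm_eq (hD : Odd D) (f : CuspForm (Gamma0 64) 2) (z : ℍ)
    (k₀ : Fin 3 → ℤ) :
    IntegrableOn (liftTerm D f z k₀) (orbitDomain k₀) ∧
    ∑' q : Gamma0Plus 64 ⧸ stabK k₀, ∫ w in liftDomain, liftTerm D f z (q.out • k₀) w =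
      ∫ w in orbitDomain k₀, liftTerm D f z k₀ w := by
  haveI : Countable (cosetRepInv k₀) := Subtype.countable
  set ψ := liftTerm D f z k₀ with hψ
  -- term(q.out • k₀)(w) = ψ((q.out)⁻¹ • w)
  have hterm : ∀ q : Gamma0Plus 64 ⧸ stabK k₀, ∀ w,
      liftTerm D f z (q.out • k₀) w = ψ ((q.out)⁻¹ • w) := by
    intro q w
    rw [liftTerm_smul D hD, coe_inv_smul]
  -- integrability on `F_{k₀}`
  have hint_piece : ∀ r : cosetRepInv k₀, IntegrableOn ψ ((r : Gamma0Plus 64) • liftDomain) := by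
    rintro ⟨r, q, rfl⟩
    rw [integrableOn_smul_set_iff]
    have := integrableOn_liftTerm D f z (q.out • k₀)
    refine this.congr_fun (fun w _ ↦ ?_) measurableSet_liftDomain
    exact hterm q w
  have hsum_piece : Summable fun r : cosetRepInv k₀ ↦ ∫ w in (r : Gamma0Plus 64) • liftDomain, ‖ψ w‖ := by
    -- through the bijection with the quotient and the orbit of `k₀`
    have h1 : Summable fun q : Gamma0Plus 64 ⧸ stabK k₀ ↦
        ∫ w in liftDomain, ‖liftTerm D f z (q.out • k₀) w‖ := by
      have hinj : Function.Injective fun q : Gamma0Plus 64 ⧸ stabK k₀ ↦ q.out • k₀ := by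
        intro q q' h
        have hmem : (q'.out)⁻¹ * q.out ∈ stabK k₀ := by
          rw [MulAction.mem_stabilizer_iff, mul_smul (q'.out)⁻¹ q.out k₀]
          have h' : q.out • k₀ = q'.out • k₀ := h
          rw [h', inv_smul_smul]
        have := QuotientGroup.eq.mpr hmem
        rw [QuotientGroup.out_eq', QuotientGroup.out_eq'] at this
        exact this.symm
      exact (summable_integral_norm_liftTerm D f z).comp_injective hinj
    refine (quotEquivCosetRepInv k₀).summable_iff.mp ?_
    convert h1 using 1
    funext q
    simp only [Function.comp_apply, quotEquivCosetRepInv, Equiv.ofBijective_apply]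
    rw [setIntegral_smul_set]
    refine integral_congr_ae (Eventually.of_forall fun w ↦ ?_)
    simp only [hterm q w]
  have hint : IntegrableOn ψ (orbitDomain k₀) := by
    rw [orbitDomain, biUnion_eq_iUnion]
    exact integrableOn_iUnion_of_summable_integral_norm hint_piece hsum_piece
  refine ⟨hint, ?_⟩
  -- the identity
  rw [orbitDomain, setIntegral_iUnion_smul_eq_tsum isFundamentalDomain_liftDomain (cosetRepInv k₀)
    (by simpa only [orbitDomain] using hint)]
  rw [← (quotEquivCosetRepInv k₀).tsum_eq]
  refine tsum_congr fun q ↦ ?_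
  simp only [quotEquivCosetRepInv, Equiv.ofBijective_apply]
  refine integral_congr_ae (Eventually.of_forall fun w ↦ ?_)
  exact hterm q w

end OrbitIdentity

/-! ### Subgroups of `Γ₀(64)⁺` acting on `ℍ`: measurability and invariance -/

section Instances

variable (H : Subgroup (Gamma0Plus 64))

/-- `instMeasurableSingletonClassSub` (auxiliary). [folklore] -/
instance instMeasurableSingletonClassSub : MeasurableSingletonClass H := ⟨fun _ ↦ MeasurableSet.of_discrete⟩

/-- The action of a subgroup of `Γ₀(64)⁺` on `ℍ` is measurable. [folklore] -/
instance instMeasurableSMulSub : MeasurableSMul H ℍ where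
  measurable_const_smul c := (continuous_sl2z_smul (((c : Gamma0Plus 64) : SL(2, ℤ)))).measurable
  measurable_smul_const _ := measurable_of_countable _

/-- The hyperbolic measure is invariant under every subgroup of `Γ₀(64)⁺`. [folklore] -/
instance instSMulInvariantMeasureSub : SMulInvariantMeasure H ℍ (volume : Measure ℍ) := by
  refine ⟨fun c s hs ↦ ?_⟩
  exact (measurePreserving_smul
    (Matrix.SpecialLinearGroup.mapGL ℝ (((c : Gamma0Plus 64) : SL(2, ℤ))) : GL (Fin 2) ℝ)
    (volume : Measure ℍ)).measure_preimage hs.nullMeasurableSet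

end Instances

variable (D) in
/-- **Invariance of `term(k₀)` under the stabiliser of `k₀`.** [folklore] -/
theorem liftTerm_stab_invariant (hD : Odd D) (f : CuspForm (Gamma0 64) 2) (z : ℍ) (k₀ : Fin 3 → ℤ)
    (γ : stabK k₀) (w : ℍ) : liftTerm D f z k₀ (γ • w) = liftTerm D f z k₀ w := by
  have hfix : (γ : Gamma0Plus 64) • k₀ = k₀ := γ.2
  have h := liftTerm_smul D hD f z (γ : Gamma0Plus 64) k₀ (γ • w)
  rw [hfix] at h
  rw [h]
  congr 1
  show ((γ : Gamma0Plus 64) : SL(2, ℤ))⁻¹ • (((γ : Gamma0Plus 64) : SL(2, ℤ)) • w) = w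
  rw [inv_smul_smul]

/-- Translating a set integral by an element of `SL₂(ℤ)`. [folklore] -/
theorem setIntegral_sl_smul_set {E : Type*} [NormedAddCommGroup E] [NormedSpace ℝ E] (g : SL(2, ℤ))
    (ψ : ℍ → E) (S : Set ℍ) : ∫ x in g • S, ψ x = ∫ x in S, ψ (g • x) := by
  have hmp := measurePreserving_smul g (volume : Measure ℍ)
  rw [← Set.image_smul, hmp.setIntegral_image_emb (measurableEmbedding_const_smul g) ψ S]

/-- Integrability transported along a translation by `SL₂(ℤ)`. [folklore] -/
theorem integrableOn_sl_smul_set_iff {E : Type*} [NormedAddCommGroup E] (g : SL(2, ℤ)) (ψ : ℍ → E)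
    (S : Set ℍ) : IntegrableOn ψ (g • S) ↔ IntegrableOn (fun x ↦ ψ (g • x)) S := by
  have hmp := measurePreserving_smul g (volume : Measure ℍ)
  rw [← Set.image_smul]
  exact hmp.integrableOn_image (measurableEmbedding_const_smul g)


end Literature.NumberTheory.EllipticCurves.Shintani
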